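import Summits.QuantumFields.YangMills.Theorems.UnitScaleTiltProp7SymSliceWitnessRegPr
import Summits.QuantumFields.YangMills.Theorems.UnitScaleTiltProp7B8Prop7Div
import Summits.QuantumFields.YangMills.Theorems.UnitScaleTiltProp7PV3CDELogChart
import HarnessLib

/-!
# `UnitScaleTiltProp7SymSliceWitnessKnitRow` — THE KNIT v2.6ˢ's DISPLAYED ROW `hWit` (CHART-ΣS WITNESS) AS A THEOREM, IN THE KNIT'S EXACT BINDER SHAPE
# (route `UnitScaleTilt`, crux K1 «MinimiserStabilityRegPr» stmt-QuantumFields-19200, stub EX `stub_existenceMinimalOrbit`, route (α), node (α-S), OWNER RULING g26-№19 ∕ ACK 33 ∕ ACK 34 (J1);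
# def-free, count-neutral, `--supports stmt-QuantumFields-19200 --as helper`)

Cell `ym3-torus` ∕ width seat `ym-ust-20520-w5` (gen 4).  YM₃ on T³ is ladder rung R3 (HUMAN RULING D-0037) — not d = 4, not a mass gap, not the Clay problem; nothing
here is a claim about the stub, the crux or the gap.

WHAT.  The knit ✓`Prop7StubEXOfChartPiecesTwS.stubEX_of_chartPiecesTwS` (★w2-19200 g3, v2.6ˢ) and FILE Aˢ ✓`Prop7ChartPiecesTwS.hChart_of_piecesTwS` DISPLAY the CHART-ΣS witness as
`hWit : ∀ X, (∀ b, (X b).IsHermitian ∧ tr (X b) = 0) → nMax19 F n K U₀ X < e → ∃ u, NormS F n K h U₀ X (expHermField X) u` at a printed-regular background `RegPr F n K ε₀ U₀`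
(per member; in the knit under `∀ L > 1, ∀ i : Idx L`, with `ε₀ := α L`, `e := ef L`).  This file PROVES that row from the knit's OWN numerals — (WF) `10¹²L³ε₀ ≤ 1`, `10⁹L²e ≤ 1`
and (W137) `10⁷L³·178(ε₀ + e) ≤ 1` — by ✓`Prop7SymSliceWitness.exists_normS_of_regPr_of_size` (the witness, fully discharged: ✓p620079 residual freedom of (1.19) + ✓p620506 +
★w3-20520 g4's ✓`frameTwS_mem_specialUnitaryUnits_of_regPr`), the (19)-size reading ✓`Prop7TPrint.nMax19_lt_iff`, and the chart point's regularity [Balaban1985RegularSpaces] Prop. 7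
(✓`Prop7B8Prop7Div.regPr_emb15_of_in19` ∘ ✓`Prop7PV3CDELogChart.in19_expHermField_of_nMax19_lt`: `e^{iX}U₀ ∈ 𝔘_k(178(ε₀ + e))`).

WHAT IS PROVED (sorry-free, no definition): `quarter_of_w137` (the numeral (W137) gives `ε₀ + e ≤ 1∕4`); ★★★`hWit_of_regPr` — the displayed row, per member, verbatim shape;
`hWit_of_regPr'` — the same with the RegPr radius `a ≤ ε₀` decoupled (for consumers holding `RegPr F n K a U₀`, `a ≤ ε₀`).
HONEST SCOPE.  Composition by name; no estimate; the knit's OTHER displayed rows (N06 ×2, Prop. 4, `h46tw`, `hMe`, (W137), `hBH0`, (W47q)∕(W47R), `h102`, `h129`, `h102L`, `h129L`, `hrε`,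
`hXtw″`, (γ), Thm 2 sockets) are untouched; the stub EX is NOT closed by this file.  `--supports stmt-QuantumFields-19200 --as helper`.

References: T. Bałaban, CMP **102** (1985) 277–309 [Balaban1985Variational] ((2) p.278, (19)–(20) p.281, Prop. 7 p.299); CMP **99** (1985) 75–102 [Balaban1985RegularSpaces]
((1.19) p.79, (1.28)–(1.31) pp.81–82, Prop. 7 p.98); CMP **98** (1985) 17–51 [Balaban1985Averaging] ((87) p.31, (97) p.32).
-/

set_option autoImplicit false

noncomputable section

namespace Summit.QuantumFields.YangMills.Theorems.Prop7SymSliceWitness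

open NormedSpace
open Literature.MathematicalPhysics.QuantumFieldTheory.Balaban1983to89

section T3

open scoped Matrix.Norms.L2Operator
open Literature.MathematicalPhysics.QuantumFieldTheory.Balaban1983to89.T3ContinuumYM3Torus
open Literature.MathematicalPhysics.QuantumFieldTheory.Balaban1983to89.T3PrintedRegularMinimiser (RegPr)
open Literature.MathematicalPhysics.QuantumFieldTheory.Balaban1983to89.T3PrintedMinimiserExistence (regPr_mono)
open T3Thm1Carrier (Idx)
open T3SectALandauChart (emb15 eta In19)
open Summit.QuantumFields.YangMills.Theorems.Prop7SPrint (NormS)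
open Summit.QuantumFields.YangMills.Theorems.Prop7TPrint (nMax19 nMax19_lt_iff expHermField)
open Summit.QuantumFields.YangMills.Theorems.Prop7B8Prop7Div (regPr_emb15_of_in19)
open Summit.QuantumFields.YangMills.Theorems.Prop7PV3CDELogChart (in19_expHermField_of_nMax19_lt)

variable (F : T3Family) {n K : ℕ} (h : n ≤ K)

/-- The knit's numeral (W137) `10⁷L³·178(ε₀ + e) ≤ 1` (`L ≥ 3` for a member) puts `ε₀ + e` far inside [Balaban1985RegularSpaces] Prop. 7's radius `¼`.
[cite: Balaban1985RegularSpaces, Prop. 7 p.98; Balaban1985Variational, (2) p.278] -/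
theorem quarter_of_w137 {ε₀ e : ℝ} (hε₀ : 0 ≤ ε₀) (he : 0 ≤ e) (hw137 : 10 ^ 7 * (F.L : ℝ) ^ 3 * (178 * (ε₀ + e)) ≤ 1) : ε₀ + e ≤ 1 / 4 := by
  have hL : (3 : ℝ) ≤ F.L := by
    have h3 : 3 ≤ F.L := by
      obtain ⟨⟨t, ht⟩, h1⟩ := F.hL
      omega
    exact_mod_cast h3
  have hL3 : (27 : ℝ) ≤ (F.L : ℝ) ^ 3 := by
    have h := pow_le_pow_left₀ (by norm_num : (0 : ℝ) ≤ 3) hL 3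
    norm_num at h
    exact h
  nlinarith [mul_le_mul_of_nonneg_right hL3 (by positivity : (0 : ℝ) ≤ 10 ^ 7 * (178 * (ε₀ + e)))]

/-- ★★★ **THE KNIT v2.6ˢ's DISPLAYED ROW `hWit`, PROVED** (per member, the binder shape of ✓`Prop7ChartPiecesTwS.hChart_of_piecesTwS` ∕ ✓`stubEX_of_chartPiecesTwS` verbatim): at a
printed-regular background `U₀ ∈ 𝔘_k(ε₀)` with the knit's numerals (WF) `10¹²L³ε₀ ≤ 1`, `10⁹L²e ≤ 1` and (W137) `10⁷L³·178(ε₀ + e) ≤ 1`, EVERY bondwise Hermitian traceless `X`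
of (19)-size `nMax19 F n K U₀ X < e` admits the symmetric slice's gauge transformation: `∃ u, NormS F n K h U₀ X (e^{iX}) u` (`(e^{iX}U₀)^u ∈ Ax_k(𝔅_k, U₀)`, `u↓ = (w^{sym}_{iX})⁻¹`).
Proof: `e^{iX}U₀ ∈ 𝔘_k(178(ε₀ + e))` ([Balaban1985RegularSpaces] Prop. 7, ✓`regPr_emb15_of_in19`), `‖X(b)‖ ≤ e·η` (✓`nMax19_lt_iff`), then ✓`exists_normS_of_regPr_of_size`.
[cite: Balaban1985RegularSpaces, (1.19) p.79, (1.28)–(1.30) p.81, Prop. 7 p.98; Balaban1985Averaging, (87) p.31; Balaban1985Variational, (2) p.278, (19)–(20) p.281, p.299] -/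
theorem hWit_of_regPr {ε₀ e : ℝ} (hε₀ : 0 < ε₀) (hWε : 10 ^ 12 * (F.L : ℝ) ^ 3 * ε₀ ≤ 1) (he : 0 < e) (hWe : 10 ^ 9 * (F.L : ℝ) ^ 2 * e ≤ 1)
    (hw137 : 10 ^ 7 * (F.L : ℝ) ^ 3 * (178 * (ε₀ + e)) ≤ 1)
    {U₀ : GaugeField (F.P K) 0 (Matrix.specialUnitaryGroup (Fin 2) ℂ)} (hreg : RegPr F n K ε₀ U₀) :
    ∀ X : PBond (F.P K) 0 → Matrix (Fin 2) (Fin 2) ℂ, (∀ b : PBond (F.P K) 0, (X b).IsHermitian ∧ Matrix.trace (X b) = 0) → nMax19 F n K U₀ X < e →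
      ∃ u : GaugeTransf (F.P K) 0 (Matrix.specialUnitaryGroup (Fin 2) ℂ), NormS F n K h U₀ X (expHermField X) u := by
  intro X hX hlt
  have hε₂ : ε₀ + e ≤ 1 / 4 := quarter_of_w137 F hε₀.le he.le hw137
  have h19 : In19 F n K (ε₀ + e) U₀ (expHermField X) X := in19_expHermField_of_nMax19_lt hX (hlt.trans_le (by linarith))
  have hU₁ : RegPr F n K (178 * (ε₀ + e)) (emb15 U₀ (expHermField X)) := regPr_emb15_of_in19 F n K hε₂ (by linarith) hreg h19
  have hXe : ∀ b : PBond (F.P K) 0, ‖X b‖ ≤ e * eta F n K := fun b => ((nMax19_lt_iff.1 hlt).1 b).le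
  exact exists_normS_of_regPr_of_size F h hε₀ hWε (by positivity) hw137 he.le hWe hreg hX hXe hU₁

/-- The same row for a background of SMALLER printed-regular radius `a ≤ ε₀` (`RegPr` is monotone in the radius, ✓`regPr_mono`) — the shape some knit places hold
(`RegPr … ρ U₀ → ρ ≤ α L → …`). [cite: Balaban1985Variational, (2) p.278, (19)–(20) p.281] -/
theorem hWit_of_regPr' {ε₀ e a : ℝ} (hε₀ : 0 < ε₀) (hWε : 10 ^ 12 * (F.L : ℝ) ^ 3 * ε₀ ≤ 1) (he : 0 < e) (hWe : 10 ^ 9 * (F.L : ℝ) ^ 2 * e ≤ 1)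
    (hw137 : 10 ^ 7 * (F.L : ℝ) ^ 3 * (178 * (ε₀ + e)) ≤ 1)
    {U₀ : GaugeField (F.P K) 0 (Matrix.specialUnitaryGroup (Fin 2) ℂ)} (hreg : RegPr F n K a U₀) (ha : a ≤ ε₀) :
    ∀ X : PBond (F.P K) 0 → Matrix (Fin 2) (Fin 2) ℂ, (∀ b : PBond (F.P K) 0, (X b).IsHermitian ∧ Matrix.trace (X b) = 0) → nMax19 F n K U₀ X < e →
      ∃ u : GaugeTransf (F.P K) 0 (Matrix.specialUnitaryGroup (Fin 2) ℂ), NormS F n K h U₀ X (expHermField X) u :=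
  hWit_of_regPr F h hε₀ hWε he hWe hw137 (regPr_mono F ha hreg)

/-! ## v1.1 The family form: the knit's `hWit` binder VERBATIM (`∀ L > 1, ∀ i : Idx L, …` with the knit's L-indexed numerals) -/

/-- ★★★ **THE KNIT v2.6ˢ's `hWit` BINDER, VERBATIM, AS A THEOREM OF ITS OWN NUMERALS**: for L-indexed radii `α`, `ef` with (WF) `10⁹L²·ef L ≤ 1`, `10¹²L³·α L ≤ 1` and (W137)
`10⁷L³·178(α L + ef L) ≤ 1` (the hypotheses `hα`, `hef`, `hWe`, `hWε`, `hw137` of ✓`Prop7StubEXOfChartPiecesTwS.stubEX_of_chartPiecesTwS`, same spelling), the displayed row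
`∀ L > 1, ∀ i : Idx L, ∀ U₀ ∈ 𝔘_k(α L), ∀ X Hermitian traceless with nMax19 U₀ X < ef L, ∃ u, NormS U₀ X (e^{iX}) u` HOLDS — so the next knit passes
`hWit := hWit_family α ef hα hef hWe hWε hw137` and the CHART-ΣS witness leaves the display. (`i.2.1 : F.L = L` converts the member's `(F.L : ℝ)` numerals.)
[cite: Balaban1985RegularSpaces, (1.19) p.79, (1.28)–(1.30) p.81, Prop. 7 p.98; Balaban1985Averaging, (87) p.31; Balaban1985Variational, (2) p.278, (19)–(20) p.281] -/
theorem hWit_family (α ef : ℕ → ℝ) (hα : ∀ L : ℕ, 1 < L → 0 < α L) (hef : ∀ L : ℕ, 1 < L → 0 < ef L)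
    (hWe : ∀ L : ℕ, 1 < L → 10 ^ 9 * (L : ℝ) ^ 2 * ef L ≤ 1) (hWε : ∀ L : ℕ, 1 < L → 10 ^ 12 * (L : ℝ) ^ 3 * α L ≤ 1)
    (hw137 : ∀ L : ℕ, 1 < L → 10 ^ 7 * (L : ℝ) ^ 3 * (178 * (α L + ef L)) ≤ 1) :
    ∀ (L : ℕ), 1 < L → ∀ (i : Idx L) (U₀ : GaugeField (i.1.1.P i.1.2.2) 0 (Matrix.specialUnitaryGroup (Fin 2) ℂ)), RegPr i.1.1 i.1.2.1 i.1.2.2 (α L) U₀ →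
      ∀ X : PBond (i.1.1.P i.1.2.2) 0 → Matrix (Fin 2) (Fin 2) ℂ, (∀ b : PBond (i.1.1.P i.1.2.2) 0, (X b).IsHermitian ∧ Matrix.trace (X b) = 0) →
        nMax19 i.1.1 i.1.2.1 i.1.2.2 U₀ X < ef L →
        ∃ u : GaugeTransf (i.1.1.P i.1.2.2) 0 (Matrix.specialUnitaryGroup (Fin 2) ℂ), NormS i.1.1 i.1.2.1 i.1.2.2 i.2.2.le U₀ X (expHermField X) u := by
  intro L hL i U₀ hreg X hX hlt
  have hLi : (i.1.1.L : ℝ) = (L : ℝ) := by rw [i.2.1]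
  exact hWit_of_regPr i.1.1 i.2.2.le (hα L hL) (by rw [hLi]; exact hWε L hL) (hef L hL) (by rw [hLi]; exact hWe L hL)
    (by rw [hLi]; exact hw137 L hL) hreg X hX hlt

end T3

end Summit.QuantumFields.YangMills.Theorems.Prop7SymSliceWitness

end
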